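import Summits.SmoothPoincare4.SmoothPoincare4.Theses.InformationMetricHadamard
import Summits.SmoothPoincare4.SmoothPoincare4.Theorems.InformationMetricHadamardC0AhRecognitionStubFarCollarIsFar
import Summits.SmoothPoincare4.SmoothPoincare4.Theorems.InformationMetricHadamardC0AhRecognitionStubFarCollarPackage
import Literature.Geometry.Riemannian.OneFormKatoInequality
import Literature.Geometry.Riemannian.DirichletMinimiserEnergy
import Literature.Geometry.Lorentzian.CurvatureSymmetries
import Literature.Topology.FourManifolds.SeamCrossingCurve

/-!
# Stub `stub_nearLevelSection` of line `core-distance-morse` — auxiliary file 1: the inward unit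
# normal of a collar slice (crux `InformationMetricHadamard.C0AhRecognition`, stmt-SmoothPoincare4-6015)

For an end collar `Ψ : N × (0,1) → W⁵` (smooth, injective, immersive on `N × (0,t₀)`) and a level
`s < t₀`, the slice `ι(z) = Ψ(z,s)` carries a smooth `G`-unit normal field pointing into the far
part `Ψ(N × (0,s))`: the normalised `G`-gradient of the depth function `λ = pr₂ ∘ Ψ⁻¹` (smooth
near the slice by the inverse function theorem), with the sign reversed.

* `NearLevelSection.contMDiffAt_depth`, `NearLevelSection.mfderiv_depth_mfderiv` — the depth is
  smooth on the far part and `dλ(dΨ(v, σ)) = σ`;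
* `NearLevelSection.contMDiffAt_normalize` — normalising a smooth nonvanishing field is smooth;
* `helper_nearLevelSection_1` — the registered helper: a smooth unit normal `ν` along the slice,
  `G`-orthogonal to it, such that every curve leaving `Ψ(z,s)` with velocity `ν z` enters
  `Ψ(N × (0,s))` forwards and `Ψ(N × (s,t₀))` backwards.

Everything is proved (kind = proof); no definitions.
-/

noncomputable section

-- the prescribed namespace `Summit.<P>.<Sub>.…` duplicates `SmoothPoincare4` (P = Sub)
set_option linter.dupNamespace false

open scoped Manifold ContDiff Topology ENNReal NNReal
open Set Function Bundle Filter

namespace Summit.SmoothPoincare4.SmoothPoincare4.Cruxes.C0AhRecognition.CoreDistanceMorse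

open Literature.Geometry.Lorentzian (PseudoRiemannianMetric)
open Literature.Geometry.Riemannian (oneFormSection contMDiffAt_sharp_oneForm
  contMDiffAt_oneFormSection_mvfderiv)

namespace NearLevelSection

variable {N : Type} [TopologicalSpace N] [ChartedSpace (EuclideanSpace ℝ (Fin 4)) N]
  [IsManifold (𝓡 4) ∞ N]
  {W : Type} [TopologicalSpace W] [ChartedSpace (EuclideanSpace ℝ (Fin 5)) W]
  [IsManifold (𝓡 5) ∞ W]

section Depth

variable [Nonempty N] (Ψ : N × ℝ → W) {t₀ : ℝ} (ht₀ : t₀ < 1)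
  (hsm : ContMDiffOn ((𝓡 4).prod 𝓘(ℝ, ℝ)) (𝓡 5) ∞ Ψ (univ ×ˢ Ioo (0 : ℝ) 1))
  (hinj : InjOn Ψ (univ ×ˢ Ioo (0 : ℝ) 1))
  (himm : ∀ (y : N) (l : ℝ), l ∈ Ioo (0 : ℝ) t₀ →
    Injective (mfderiv ((𝓡 4).prod 𝓘(ℝ, ℝ)) (𝓡 5) Ψ (y, l)))

include ht₀ hsm hinj himm

/-- **The depth `λ = pr₂ ∘ Ψ⁻¹` is smooth on the far part** `Ψ(N × (0,t₀))` (the global inverse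
`invFunOn Ψ (N × (0,1))` is smooth there, `Sketch.collar_localInverse`). [folklore] -/
theorem contMDiffAt_depth {p : N × ℝ} (hp : p ∈ univ ×ˢ Ioo (0 : ℝ) t₀) :
    ContMDiffAt (𝓡 5) 𝓘(ℝ, ℝ) ∞ (fun x ↦ (invFunOn Ψ (univ ×ˢ Ioo (0 : ℝ) 1) x).2) (Ψ p) := by
  have h := contMDiffAt_snd.comp (Ψ p) (Sketch.collar_localInverse Ψ le_rfl ht₀ hsm hinj himm hp).2
  exact h

/-- **Differential of the depth along the collar**: `dλ(dΨ_{(y,l)}(v, σ)) = σ` for `l < t₀`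
(chain rule; `λ ∘ Ψ = pr₂` near `(y, l)`). [folklore] -/
theorem mfderiv_depth_mfderiv {y : N} {l : ℝ} (hl : l ∈ Ioo (0 : ℝ) t₀)
    (v : TangentSpace (𝓡 4) y) (σ : ℝ) :
    mfderiv (𝓡 5) 𝓘(ℝ, ℝ) (fun x ↦ (invFunOn Ψ (univ ×ˢ Ioo (0 : ℝ) 1) x).2) (Ψ (y, l))
      (mfderiv ((𝓡 4).prod 𝓘(ℝ, ℝ)) (𝓡 5) Ψ (y, l) (v, σ)) = σ := by
  set F : W → ℝ := fun x ↦ (invFunOn Ψ (univ ×ˢ Ioo (0 : ℝ) 1) x).2 with hF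
  have hsub : (univ ×ˢ Ioo (0 : ℝ) t₀ : Set (N × ℝ)) ⊆ univ ×ˢ Ioo (0 : ℝ) 1 :=
    prod_mono Subset.rfl (Ioo_subset_Ioo_right ht₀.le)
  have hp : ((y, l) : N × ℝ) ∈ (univ ×ˢ Ioo (0 : ℝ) t₀ : Set (N × ℝ)) := ⟨mem_univ _, hl⟩
  have hΨd : MDifferentiableAt ((𝓡 4).prod 𝓘(ℝ, ℝ)) (𝓡 5) Ψ (y, l) :=
    (hsm.contMDiffAt ((isOpen_univ.prod isOpen_Ioo).mem_nhds (hsub hp))).mdifferentiableAt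
      (by simp)
  have hcomp : HasMFDerivAt ((𝓡 4).prod 𝓘(ℝ, ℝ)) 𝓘(ℝ, ℝ) (F ∘ Ψ) (y, l)
      ((mfderiv (𝓡 5) 𝓘(ℝ, ℝ) F (Ψ (y, l))).comp (mfderiv ((𝓡 4).prod 𝓘(ℝ, ℝ)) (𝓡 5) Ψ (y, l))) :=
    ((contMDiffAt_depth Ψ ht₀ hsm hinj himm hp).mdifferentiableAt
      (by simp)).hasMFDerivAt.comp (y, l) hΨd.hasMFDerivAt
  -- the model computation: `F ∘ Ψ = pr₂` near `(y, l)`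
  have hmodel : HasMFDerivAt ((𝓡 4).prod 𝓘(ℝ, ℝ)) 𝓘(ℝ, ℝ) (Prod.snd : N × ℝ → ℝ) (y, l)
      (ContinuousLinearMap.snd ℝ (TangentSpace (𝓡 4) y) (TangentSpace 𝓘(ℝ, ℝ) l)) :=
    hasMFDerivAt_snd (I := 𝓡 4) (I' := 𝓘(ℝ, ℝ)) (y, l)
  have heq : F ∘ Ψ =ᶠ[𝓝 ((y, l) : N × ℝ)] (Prod.snd : N × ℝ → ℝ) := by
    filter_upwards [(isOpen_univ.prod isOpen_Ioo).mem_nhds hp] with q hq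
    exact congrArg Prod.snd (hinj.leftInvOn_invFunOn (hsub hq))
  have h2 := (hmodel.congr_of_eventuallyEq heq).mfderiv
  rw [hcomp.mfderiv] at h2
  exact DFunLike.congr_fun h2 (v, σ)

end Depth

/-- **Normalising a smooth nonvanishing field is smooth**: if `x ↦ (x, V x) ∈ TW` is `C^∞` at `x₀`
and `V x₀ ≠ 0`, then so is `x ↦ (x, -(G(V,V))^{-1/2} V x)` for a Riemannian `G` (the scalar
`x ↦ G_x(V x, V x)` is smooth and positive at `x₀`). [folklore] -/
theorem contMDiffAt_normalize
    (G : PseudoRiemannianMetric (𝓡 5) ∞ (EuclideanSpace ℝ (Fin 5)) (TangentSpace (𝓡 5) : W → Type _))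
    (hG : G.IsRiemannian) {V : Π x : W, TangentSpace (𝓡 5) x} {x₀ : W}
    (hV : ContMDiffAt (𝓡 5) ((𝓡 5).prod 𝓘(ℝ, EuclideanSpace ℝ (Fin 5))) ∞
      (fun x ↦ TotalSpace.mk' (EuclideanSpace ℝ (Fin 5)) x (V x)) x₀)
    (hx₀ : V x₀ ≠ 0) :
    ContMDiffAt (𝓡 5) ((𝓡 5).prod 𝓘(ℝ, EuclideanSpace ℝ (Fin 5))) ∞
      (fun x ↦ TotalSpace.mk' (EuclideanSpace ℝ (Fin 5)) x
        ((-(Real.sqrt (G.val x (V x) (V x)))⁻¹) • V x)) x₀ := by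
  have hq : ContMDiffAt (𝓡 5) 𝓘(ℝ, ℝ) ∞ (fun x ↦ G.val x (V x) (V x)) x₀ :=
    G.contMDiffAt_val_apply le_rfl hV hV
  have hpos : 0 < G.val x₀ (V x₀) (V x₀) := hG x₀ (V x₀) hx₀
  have hr : ContDiffAt ℝ ∞ (fun r : ℝ ↦ -(Real.sqrt r)⁻¹) (G.val x₀ (V x₀) (V x₀)) :=
    ((Real.contDiffAt_sqrt hpos.ne').inv (Real.sqrt_pos.2 hpos).ne').neg
  have hc : ContMDiffAt (𝓡 5) 𝓘(ℝ, ℝ) ∞ (fun x ↦ -(Real.sqrt (G.val x (V x) (V x)))⁻¹) x₀ :=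
    ContDiffAt.comp_contMDiffAt (g := fun r : ℝ ↦ -(Real.sqrt r)⁻¹)
      (f := fun x ↦ G.val x (V x) (V x)) (x := x₀) hr hq
  exact hc.smul_section hV

end NearLevelSection

/-- **Helper 1 for stub E2 (`nearLevelSection`): the inward unit normal of a collar slice.**
Let `Ψ : N × ℝ → W⁵` be smooth and injective on `N × (0,1)` and immersive on `N × (0,t₀)`,
`t₀ < 1`, and let `s ∈ (0,t₀)`. Then along the slice `z ↦ Ψ(z,s)` there is a field `ν` with
`z ↦ (Ψ(z,s), ν z) ∈ TW` smooth, `G(ν,ν) = 1`, `ν ⊥_G` the slice, and such that every curve `γ`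
with `γ(0) = Ψ(z,s)`, differentiable at `0` with `γ'(0) = ν z`, lies in `Ψ(N × (0,s))` for small
`t > 0` and in `Ψ(N × (s,t₀))` for small `t < 0`. Construction: `ν = -♯dλ/|♯dλ|_G` for the depth
`λ = pr₂ ∘ Ψ⁻¹` (`dλ ∘ dΨ_{(z,s)} = pr₂`, so `dλ ≠ 0`, `dλ` kills the slice directions, and
`(λ ∘ γ)'(0) = dλ(ν z) = -|♯dλ|_G < 0`). [folklore] -/
theorem helper_nearLevelSection_1
    (N : Type) [TopologicalSpace N] [ChartedSpace (EuclideanSpace ℝ (Fin 4)) N] [IsManifold (𝓡 4) ∞ N]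
    (W : Type) [TopologicalSpace W] [ChartedSpace (EuclideanSpace ℝ (Fin 5)) W] [IsManifold (𝓡 5) ∞ W]
    (G : PseudoRiemannianMetric (𝓡 5) ∞ (EuclideanSpace ℝ (Fin 5)) (TangentSpace (𝓡 5) : W → Type _))
    (hG : G.IsRiemannian) (Ψ : N × ℝ → W)
    (hsm : ContMDiffOn ((𝓡 4).prod 𝓘(ℝ, ℝ)) (𝓡 5) ∞ Ψ (univ ×ˢ Ioo (0 : ℝ) 1))
    (hinj : InjOn Ψ (univ ×ˢ Ioo (0 : ℝ) 1))
    (t₀ : ℝ) (ht₀ : t₀ ∈ Ioo (0 : ℝ) 1)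
    (himm : ∀ (y : N) (l : ℝ), l ∈ Ioo (0 : ℝ) t₀ →
      Injective (mfderiv ((𝓡 4).prod 𝓘(ℝ, ℝ)) (𝓡 5) Ψ (y, l)))
    (s : ℝ) (hs : s ∈ Ioo (0 : ℝ) t₀) :
    ∃ ν : Π z : N, TangentSpace (𝓡 5) (Ψ (z, s)),
      ContMDiff (𝓡 4) (𝓡 5).tangent ∞ (fun z ↦
        (Bundle.TotalSpace.mk' (EuclideanSpace ℝ (Fin 5)) (Ψ (z, s)) (ν z) : TangentBundle (𝓡 5) W)) ∧
      (∀ z : N, G.val (Ψ (z, s)) (ν z) (ν z) = 1) ∧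
      (∀ (z : N) (w : TangentSpace (𝓡 4) z),
        G.val (Ψ (z, s)) (mfderiv (𝓡 4) (𝓡 5) (fun y : N ↦ Ψ (y, s)) z w) (ν z) = 0) ∧
      (∀ (z : N) (γ : ℝ → W), γ 0 = Ψ (z, s) → MDifferentiableAt 𝓘(ℝ, ℝ) (𝓡 5) γ 0 →
        mfderiv 𝓘(ℝ, ℝ) (𝓡 5) γ 0 1 = ν z →
        (∀ᶠ t in 𝓝[>] (0 : ℝ), γ t ∈ Ψ '' (univ ×ˢ Ioo (0 : ℝ) s)) ∧
        (∀ᶠ t in 𝓝[<] (0 : ℝ), γ t ∈ Ψ '' (univ ×ˢ Ioo s t₀))) := by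
  -- the empty cross-section: nothing to do
  rcases isEmpty_or_nonempty N with hN | hN
  · exact ⟨fun z ↦ isEmptyElim z, fun z ↦ isEmptyElim z, fun z ↦ isEmptyElim z,
      fun z ↦ isEmptyElim z, fun z ↦ isEmptyElim z⟩
  have hs1 : s ∈ Ioo (0 : ℝ) 1 := ⟨hs.1, hs.2.trans ht₀.2⟩
  have hsub : (univ ×ˢ Ioo (0 : ℝ) t₀ : Set (N × ℝ)) ⊆ univ ×ˢ Ioo (0 : ℝ) 1 :=
    prod_mono Subset.rfl (Ioo_subset_Ioo_right ht₀.2.le)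
  have hzs : ∀ z : N, ((z, s) : N × ℝ) ∈ (univ ×ˢ Ioo (0 : ℝ) t₀ : Set (N × ℝ)) :=
    fun z ↦ ⟨mem_univ _, hs⟩
  -- the depth, its gradient, and the normalising factor
  set Λ : W → ℝ := fun x ↦ (invFunOn Ψ (univ ×ˢ Ioo (0 : ℝ) 1) x).2 with hΛ
  set V : Π x : W, TangentSpace (𝓡 5) x :=
    fun x ↦ G.sharp x (mvfderiv (𝓡 5) Λ x).toLinearMap with hV
  set c : W → ℝ := fun x ↦ -(Real.sqrt (G.val x (V x) (V x)))⁻¹ with hc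
  have hVw : ∀ (x : W) (w : TangentSpace (𝓡 5) x),
      G.val x (V x) w = mfderiv (𝓡 5) 𝓘(ℝ, ℝ) Λ x w := fun x w ↦ by
    rw [hV, G.val_sharp_apply]
    rfl
  have hΛs : ∀ z : N, Λ (Ψ (z, s)) = s := fun z ↦
    congrArg Prod.snd (hinj.leftInvOn_invFunOn (hsub (hzs z)))
  -- `dλ(dΨ(0,1)) = 1`, so `V ≠ 0` along the slice and `q = G(V,V) > 0`
  have hV1 : ∀ z : N, G.val (Ψ (z, s)) (V (Ψ (z, s)))
      (mfderiv ((𝓡 4).prod 𝓘(ℝ, ℝ)) (𝓡 5) Ψ (z, s) ((0 : TangentSpace (𝓡 4) z), (1 : ℝ))) = 1 :=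
    fun z ↦ by rw [hVw]; exact NearLevelSection.mfderiv_depth_mfderiv Ψ ht₀.2 hsm hinj himm hs 0 1
  have hVne : ∀ z : N, V (Ψ (z, s)) ≠ 0 := fun z h ↦ by
    have h1 := hV1 z
    rw [h, map_zero] at h1
    simp at h1
  have hqpos : ∀ z : N, 0 < G.val (Ψ (z, s)) (V (Ψ (z, s))) (V (Ψ (z, s))) :=
    fun z ↦ hG _ _ (hVne z)
  have hcsq : ∀ z : N, c (Ψ (z, s)) ^ 2 * G.val (Ψ (z, s)) (V (Ψ (z, s))) (V (Ψ (z, s))) = 1 := by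
    intro z
    have hq := hqpos z
    have hcz : c (Ψ (z, s)) = -(Real.sqrt (G.val (Ψ (z, s)) (V (Ψ (z, s))) (V (Ψ (z, s)))))⁻¹ :=
      rfl
    rw [hcz, neg_sq, inv_pow, Real.sq_sqrt hq.le, inv_mul_cancel₀ hq.ne']
  have hcneg : ∀ z : N, c (Ψ (z, s)) < 0 := fun z ↦ by
    simp only [hc, neg_lt_zero, inv_pos]
    exact Real.sqrt_pos.2 (hqpos z)
  refine ⟨fun z ↦ c (Ψ (z, s)) • V (Ψ (z, s)), ?_, ?_, ?_, ?_⟩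
  · -- smoothness: a smooth section near the slice, composed with the smooth slice map
    intro z
    have hΛat : ContMDiffAt (𝓡 5) 𝓘(ℝ, ℝ) ∞ Λ (Ψ (z, s)) :=
      NearLevelSection.contMDiffAt_depth Ψ ht₀.2 hsm hinj himm (hzs z)
    have hVat : ContMDiffAt (𝓡 5) ((𝓡 5).prod 𝓘(ℝ, EuclideanSpace ℝ (Fin 5))) ∞
        (fun x ↦ TotalSpace.mk' (EuclideanSpace ℝ (Fin 5)) x (V x)) (Ψ (z, s)) :=
      contMDiffAt_sharp_oneForm G le_rfl (contMDiffAt_oneFormSection_mvfderiv hΛat)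
    have hνat := NearLevelSection.contMDiffAt_normalize G hG hVat (hVne z)
    have hι : ContMDiffAt (𝓡 4) (𝓡 5) ∞ (fun y : N ↦ Ψ (y, s)) z :=
      (FarCollarPackage.contMDiff_slice Ψ hsm hs1 z)
    rw [ModelWithCorners.tangent]
    exact hνat.comp z hι
  · -- unit length
    intro z
    simp only [map_smul, smul_apply, smul_eq_mul]
    rw [← hcsq z]
    ring
  · -- orthogonality to the slice: `dλ ∘ dΨ_{(z,s)} (w, 0) = 0`
    intro z w
    have hdι : mfderiv (𝓡 4) (𝓡 5) (fun y : N ↦ Ψ (y, s)) z w =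
        mfderiv ((𝓡 4).prod 𝓘(ℝ, ℝ)) (𝓡 5) Ψ (z, s)
          ((w, (0 : ℝ)) : TangentSpace ((𝓡 4).prod 𝓘(ℝ, ℝ)) (z, s)) := by
      rw [(FarCollarPackage.hasMFDerivAt_slice Ψ hsm hs1 z).mfderiv]
      rfl
    rw [hdι, map_smul, smul_eq_mul, G.symm, hVw,
      NearLevelSection.mfderiv_depth_mfderiv Ψ ht₀.2 hsm hinj himm hs w 0, mul_zero]
  · -- the sides: `(λ ∘ γ)'(0) = dλ(ν z) = c · G(V,V) < 0`
    intro z γ hγ0 hγd hγv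
    have hΛat : ContMDiffAt (𝓡 5) 𝓘(ℝ, ℝ) ∞ Λ (γ 0) := by
      rw [hγ0]; exact NearLevelSection.contMDiffAt_depth Ψ ht₀.2 hsm hinj himm (hzs z)
    have hΛd : MDifferentiableAt (𝓡 5) 𝓘(ℝ, ℝ) Λ (γ 0) := hΛat.mdifferentiableAt (by simp)
    -- the derivative of `λ ∘ γ` at `0`
    set d : ℝ := mfderiv (𝓡 5) 𝓘(ℝ, ℝ) Λ (γ 0) (mfderiv 𝓘(ℝ, ℝ) (𝓡 5) γ 0 1) with hd
    have hderiv : HasDerivAt (fun t ↦ Λ (γ t)) d 0 := by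
      have h₂ := hΛd.hasMFDerivAt.comp 0 hγd.hasMFDerivAt
      rw [hasMFDerivAt_iff_hasFDerivAt] at h₂
      exact HasFDerivAt.hasDerivAt
        (f' := (mfderiv (𝓡 5) 𝓘(ℝ, ℝ) Λ (γ 0)).comp (mfderiv 𝓘(ℝ, ℝ) (𝓡 5) γ 0)) h₂
    have hdval : d = c (Ψ (z, s)) * G.val (Ψ (z, s)) (V (Ψ (z, s))) (V (Ψ (z, s))) := by
      have key : ∀ (x : W) (hx : x = Ψ (z, s)) (u : TangentSpace (𝓡 5) x),
          u = (show TangentSpace (𝓡 5) x from (c (Ψ (z, s)) • V (Ψ (z, s)) :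
            TangentSpace (𝓡 5) (Ψ (z, s)))) →
          mfderiv (𝓡 5) 𝓘(ℝ, ℝ) Λ x u =
            c (Ψ (z, s)) * G.val (Ψ (z, s)) (V (Ψ (z, s))) (V (Ψ (z, s))) := by
        rintro x rfl u rfl
        rw [← hVw, map_smul, smul_eq_mul, mul_comm]
      exact key (γ 0) hγ0 _ hγv
    have hdneg : d < 0 := by
      rw [hdval]
      exact mul_neg_of_neg_of_pos (hcneg z) (hqpos z)
    -- `φ(t) = s - λ(γ t)` vanishes at `0` with positive derivative
    have hφ : HasDerivAt (fun t ↦ s - Λ (γ t)) (-d) 0 := hderiv.const_sub s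
    have hφ0 : s - Λ (γ 0) = 0 := by rw [hγ0, hΛs z, sub_self]
    obtain ⟨hplus, hminus⟩ :=
      Literature.Topology.FourManifolds.eventually_pos_and_neg_of_hasDerivAt_pos hφ hφ0
        (neg_pos.2 hdneg)
    -- near `0` the curve stays in the far part `Ψ(N × (0,t₀))`
    have hfar : ∀ᶠ t in 𝓝 (0 : ℝ), γ t ∈ Ψ '' (univ ×ˢ Ioo (0 : ℝ) t₀) := by
      have h := (Sketch.collar_localInverse Ψ le_rfl ht₀.2 hsm hinj himm (hzs z)).1
      rw [← hγ0] at h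
      exact hγd.continuousAt.eventually h
    constructor
    · filter_upwards [hplus, hfar.filter_mono nhdsWithin_le_nhds] with t ht hmem
      obtain ⟨p, hp, hpt⟩ := hmem
      have hΛp : Λ (γ t) = p.2 := by
        rw [← hpt]
        exact congrArg Prod.snd (hinj.leftInvOn_invFunOn (hsub hp))
      refine ⟨p, ⟨mem_univ _, hp.2.1, ?_⟩, hpt⟩
      linarith
    · filter_upwards [hminus, hfar.filter_mono nhdsWithin_le_nhds] with t ht hmem
      obtain ⟨p, hp, hpt⟩ := hmem
      have hΛp : Λ (γ t) = p.2 := by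
        rw [← hpt]
        exact congrArg Prod.snd (hinj.leftInvOn_invFunOn (hsub hp))
      refine ⟨p, ⟨mem_univ _, ?_, hp.2.2⟩, hpt⟩
      linarith

end Summit.SmoothPoincare4.SmoothPoincare4.Cruxes.C0AhRecognition.CoreDistanceMorse

end
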